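import Summits.SmoothPoincare4.SmoothPoincare4.Theorems.ConvexBisectionAcyclicBisectionExistsKasOpenBookTube
import Literature.Geometry.Symplectic.LefschetzSteinOpenBook
import Literature.Geometry.Symplectic.SphereOpenBookTube
import HarnessLib

/-!
# The Kas open book of a seam page function (node KOB of the NF6 assembly)
(registered sub-goal `helper_kasOpenBook_of_seamFunction` of stub `stub_steinRealisation`, line
`modp-braid-orbits`, crux `ConvexBisection.AcyclicBisectionExists`, item stmt-SmoothPoincare4-10508;
wave 2, worker V1, lead c5; design `Cruxes/AcyclicBisectionExists/NF6_Assembly_Design.lean`,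
`node_kasOpenBook_of_seamFunction`)

Sequel of `…KasOpenBookTube.lean` (the Kas tube `kasTube D bX hpage : 𝕊¹ × ℝ² → ∂X`).  Let
`X = Base g ∪_{h} (2-handles)` with data `D`, all attaching circles in pages, `bX` a boundary datum
and `F : ∂X → ℂ` a SEAM PAGE FUNCTION: smooth, a positive real multiple of `w(a)` at every
unsurgered point `bX.incl y = D.jA a`, vanishing only at unsurgered points, with `d(arg F) ≠ 0` off
its zeros.  Then (Kas 1980; Gompf–Stipsicz 1999, §8.2; Etnyre 2006, §2: the boundary of a Lefschetz
fibration over `D²` carries the open book whose pages are the fibres over `∂D²`):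

* §1 `argProj F = F/‖F‖ : N → 𝕊¹` for any complex function on a `3`-manifold: smooth off the zero
  set, with angular differential `dθ_y(v) = Im(conj(F y) · dF_y(v))/‖F y‖²`
  (`angularDeriv_argProj`, via `SphereOpenBook.hasFDerivAt_normalize`/`angleForm_normalize`);
* §4 **`kasOpenBookOf`** — the open book (`Literature.Geometry.Symplectic.OpenBook`) of `∂X` with
  the ONE tube `kasTube` and fibration `argProj F`: normal form because `F ∘ kasTube (p, v)` is a
  positive multiple of `v` (`apply_kasTube_eq`), binding `{F = 0}` (`mem_binding_kasOpenBookOf_iff`),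
  and it IS the Kas boundary open book of `(h, D)` (`isKasOpenBookOf_kasOpenBookOf`:
  `Literature.Geometry.Symplectic.IsKasOpenBookOf`, binding = image of the base binding `{w = 0}`,
  fibration = page angle `w/‖w‖` at unsurgered points);
* §5 `helper_kasOpenBook_of_seamFunction` (registered) — the node statement; the design's
  `cderiv F y v` is spelled `@id ℂ (mfderiv (𝓡 3) 𝓘(ℝ, ℂ) F y v)` (its `δ`-unfolding, no new name).

Everything here is proved; no named facts.

## References
* A. Kas, *On the handlebody decomposition associated to a Lefschetz fibration*, Pacific J. Math.
  89 (1980), 89–104. [Kas1980]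
* R. E. Gompf, A. I. Stipsicz, *4-Manifolds and Kirby Calculus*, GSM 20 (1999), §8.2. [GompfStipsicz1999]
* J. B. Etnyre, *Lectures on open book decompositions and contact structures*, Clay Math. Proc. 5
  (2006), §2. [Etnyre2006]
* R. İ. Baykur, *Kähler decomposition of 4-manifolds*, AGT 6 (2006), proof of Thm. 5.1. [Baykur2006]
-/

noncomputable section

-- the prescribed namespace `Summit.<P>.<Sub>.…` duplicates `SmoothPoincare4` (P = Sub)
set_option linter.dupNamespace false

open scoped Manifold ContDiff Topology ComplexConjugate

namespace Summit.SmoothPoincare4.SmoothPoincare4.Theorems.AcyclicBisectionExists.ModpBraidOrbits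

open Set Function
open Literature.Topology.FourManifolds Literature.Topology.FourManifolds.HandleAttachingMap
  Literature.Topology.FourManifolds.LefschetzBase Literature.Geometry.Symplectic

universe u v

/-! ### §1 The argument `F/‖F‖` of a complex function on a `3`-manifold as a map to the circle -/

section ArgProj

variable {N : Type u}

/-- **The argument map `y ↦ F(y)/‖F(y)‖ ∈ 𝕊¹ ⊂ ℝ²`** of a complex-valued function `F` (junk value
on the zero set of `F`): the normalisation `RotationBody.sphN` of the plane vector `vec2 (F y)`.
[folklore] -/
def argProj (F : N → ℂ) (y : N) : Metric.sphere (0 : EuclideanSpace ℝ (Fin 2)) 1 :=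
  RotationBody.sphN (m := 1) (vec2 (F y))

/-- Off the zero set, `F/‖F‖` read in `ℝ²` is `‖F y‖⁻¹ • vec2 (F y)`. [folklore] -/
theorem coe_argProj {F : N → ℂ} {y : N} (hy : F y ≠ 0) :
    ((argProj F y : Metric.sphere (0 : EuclideanSpace ℝ (Fin 2)) 1) : EuclideanSpace ℝ (Fin 2)) =
      ‖F y‖⁻¹ • vec2 (F y) := by
  rw [argProj, RotationBody.coe_sphN ((vec2_eq_zero_iff _).not.2 hy), norm_vec2]

/-- Off the zero set, `F/‖F‖` read in `ℂ` is `F y / ‖F y‖`. [folklore] -/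
theorem toC_argProj {F : N → ℂ} {y : N} (hy : F y ≠ 0) :
    toC ((argProj F y : Metric.sphere (0 : EuclideanSpace ℝ (Fin 2)) 1) : EuclideanSpace ℝ (Fin 2)) =
      F y / (‖F y‖ : ℂ) := by
  rw [coe_argProj hy, toC_smul, toC_vec2, div_eq_inv_mul, Complex.ofReal_inv]

/-- A positive real factor does not change the argument: if `F y = c * z` with `c > 0` and
`z ≠ 0`, then `argProj F y` read in `ℝ²` is `z/‖z‖`, i.e. `‖vec2 z‖⁻¹ • vec2 z`. [folklore] -/
theorem coe_argProj_of_eq_mul {F : N → ℂ} {y : N} {c : ℝ} {z : ℂ} (hc : 0 < c) (hz : z ≠ 0)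
    (hF : F y = c * z) :
    ((argProj F y : Metric.sphere (0 : EuclideanSpace ℝ (Fin 2)) 1) : EuclideanSpace ℝ (Fin 2)) =
      ‖vec2 z‖⁻¹ • vec2 z := by
  have hz' : vec2 z ≠ 0 := (vec2_eq_zero_iff _).not.2 hz
  rw [argProj, hF, vec2_ofReal_mul, RotationBody.sphN_smul hc hz', RotationBody.coe_sphN hz']

/-- `argProj F` read in `ℝ²` is `sphFun ∘ vec2 ∘ F` (definitional). [folklore] -/
theorem coe_argProj_eq (F : N → ℂ) :
    (fun y => ((argProj F y : Metric.sphere (0 : EuclideanSpace ℝ (Fin 2)) 1) :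
      EuclideanSpace ℝ (Fin 2))) = (RotationBody.sphFun ∘ vec2) ∘ F :=
  rfl

variable [TopologicalSpace N] [ChartedSpace (EuclideanSpace ℝ (Fin 3)) N]

/-- **`F/‖F‖` is smooth off the zero set of a smooth `F`.** [folklore] -/
theorem contMDiffOn_argProj {F : N → ℂ} (hF : ContMDiff (𝓡 3) 𝓘(ℝ, ℂ) ∞ F) :
    ContMDiffOn (𝓡 3) (𝓡 1) ∞ (argProj F) {y | F y ≠ 0} :=
  RotationBody.contMDiffOn_sphN.comp (contDiff_vec2.contMDiff.comp hF).contMDiffOn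
    fun _ hy => (vec2_eq_zero_iff _).not.2 hy

/-- **The angular differential of `F/‖F‖`**: at a point `y` with `F y ≠ 0`,
`dθ_y(v) = Im(conj(F y) · dF_y(v)) / ‖F y‖²` — the derivative of `arg F` along `v`
(the normalisation `u ↦ u/‖u‖` has differential `‖u‖⁻¹ h + ℓ(h) u`, and the angle form kills the
radial component, `SphereOpenBook.angleForm_normalize`). [folklore] -/
theorem angularDeriv_argProj {F : N → ℂ} (hF : ContMDiff (𝓡 3) 𝓘(ℝ, ℂ) ∞ F) {y : N}
    (hy : F y ≠ 0) (v : EuclideanSpace ℝ (Fin 3)) :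
    angularDeriv (argProj F) y v =
      (‖F y‖ ^ 2)⁻¹ * ((starRingEnd ℂ) (F y) * @id ℂ (mfderiv (𝓡 3) 𝓘(ℝ, ℂ) F y v)).im := by
  -- adapted from `SphereOpenBook.angularDeriv_proj`
  -- (Literature/Geometry/Symplectic/SphereOpenBookTube.lean)
  set u : EuclideanSpace ℝ (Fin 2) := vec2 (F y) with hu_def
  have hu : u ≠ 0 := (vec2_eq_zero_iff _).not.2 hy
  obtain ⟨ℓ, hℓ⟩ := SphereOpenBook.hasFDerivAt_normalize hu
  set L : EuclideanSpace ℝ (Fin 2) →L[ℝ] EuclideanSpace ℝ (Fin 2) :=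
    ‖u‖⁻¹ • ContinuousLinearMap.id ℝ (EuclideanSpace ℝ (Fin 2)) + ℓ.smulRight u with hL
  -- the plane map `sphFun ∘ vec2` is differentiable at `F y` with derivative `L ∘ vec2L`
  have hg : HasFDerivAt (RotationBody.sphFun ∘ vec2) (L.comp vec2L) (F y) :=
    (hℓ.congr_of_eventuallyEq (SphereOpenBook.sphFun_eventuallyEq hu)).comp (F y) vec2L.hasFDerivAt
  have hgm : HasMFDerivAt 𝓘(ℝ, ℂ) 𝓘(ℝ, EuclideanSpace ℝ (Fin 2)) (RotationBody.sphFun ∘ vec2) (F y)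
      (L.comp vec2L) :=
    hasMFDerivAt_iff_hasFDerivAt.2 hg
  have hFd : HasMFDerivAt (𝓡 3) 𝓘(ℝ, ℂ) F y (mfderiv (𝓡 3) 𝓘(ℝ, ℂ) F y) :=
    ((hF y).mdifferentiableAt (by simp)).hasMFDerivAt
  have hcomp := hgm.comp y hFd
  rw [angularDeriv_apply, coe_argProj_eq, hcomp.mfderiv]
  have hp : ((argProj F y : Metric.sphere (0 : EuclideanSpace ℝ (Fin 2)) 1) :
      EuclideanSpace ℝ (Fin 2)) = ‖u‖⁻¹ • u := RotationBody.coe_sphN hu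
  rw [hp]
  show angleForm (‖u‖⁻¹ • u) (L (vec2L (mfderiv (𝓡 3) 𝓘(ℝ, ℂ) F y v))) = _
  rw [hL]
  show angleForm (‖u‖⁻¹ • u) (‖u‖⁻¹ • vec2 (mfderiv (𝓡 3) 𝓘(ℝ, ℂ) F y v) +
      ℓ (vec2 (mfderiv (𝓡 3) 𝓘(ℝ, ℂ) F y v)) • u) = _
  rw [SphereOpenBook.angleForm_normalize, hu_def, norm_vec2]
  simp only [id, vec2_apply_zero, vec2_apply_one, Complex.mul_im, Complex.conj_re, Complex.conj_im]
  ring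

/-- **`F/‖F‖` is a submersion where `d(arg F) ≠ 0`**: if `Im(conj(F y) · dF_y(v)) ≠ 0` for some `v`,
the angular differential of `argProj F` at `y` is non-zero. [folklore] -/
theorem angularDeriv_argProj_ne_zero {F : N → ℂ} (hF : ContMDiff (𝓡 3) 𝓘(ℝ, ℂ) ∞ F) {y : N}
    (hy : F y ≠ 0)
    (hv : ∃ v : EuclideanSpace ℝ (Fin 3),
      ((starRingEnd ℂ) (F y) * @id ℂ (mfderiv (𝓡 3) 𝓘(ℝ, ℂ) F y v)).im ≠ 0) :
    angularDeriv (argProj F) y ≠ 0 := by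
  obtain ⟨v, hv⟩ := hv
  intro h0
  have h1 : angularDeriv (argProj F) y v = 0 := by rw [h0]; rfl
  rw [angularDeriv_argProj hF hy] at h1
  have h2 : (‖F y‖ ^ 2)⁻¹ ≠ 0 := inv_ne_zero (pow_ne_zero 2 (norm_ne_zero_iff.2 hy))
  exact hv ((mul_eq_zero.1 h1).resolve_left h2)

end ArgProj

/-! ### §4 The Kas open book of a seam page function -/

section KasOpenBook

variable {g : ℕ} {ι : Type v} [Finite ι] {h : ι → HandleAttachingMap 3 2 (Base g)}
  {X : Type u} [TopologicalSpace X] [ChartedSpace (EuclideanHalfSpace 4) X]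
  (D : MultiAttachmentData h (𝓡∂ 4) X) (bX : BoundaryData (𝓡∂ 4) X (𝓡 3))
  (hpage : ∀ i, ∃ c : ℂ, ‖c‖ = 1 ∧ ∀ θ, (h i).attachingCircle θ ∈ page g c)
  {F : bX.carrier → ℂ}
  (hF1 : ∀ (y : bX.carrier) (a : ↥(coresComplement h)),
    bX.incl y = D.jA a → ∃ c : ℝ, 0 < c ∧ F y = c * w g (a : Base g).1)

include hF1 in
/-- **`F` along the Kas tube is a positive multiple of the disc coordinate**:
`F (kasTube (p, v)) = c · v` (read in `ℂ`) with `c > 0`. [folklore] -/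
theorem apply_kasTube_eq [Nonempty bX.carrier]
    (q : Metric.sphere (0 : EuclideanSpace ℝ (Fin 2)) 1 × EuclideanSpace ℝ (Fin 2)) :
    ∃ c : ℝ, 0 < c ∧ F (kasTube D bX hpage q) = c * toC q.2 := by
  obtain ⟨c, hc, hFc⟩ := hF1 _ _ (incl_kasTube D bX hpage q)
  refine ⟨c * wsc q.2, mul_pos hc (wsc_pos q.2), ?_⟩
  rw [hFc, w_seamBasePt_seamBaseTube, Complex.ofReal_mul, mul_assoc]

include hF1 in
/-- `F` vanishes on the core of the Kas tube. [folklore] -/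
theorem apply_kasTube_zero [Nonempty bX.carrier] (p : Metric.sphere (0 : EuclideanSpace ℝ (Fin 2)) 1) :
    F (kasTube D bX hpage (p, 0)) = 0 := by
  obtain ⟨c, -, hFc⟩ := apply_kasTube_eq D bX hpage hF1 (p, 0)
  rw [hFc]
  show (c : ℂ) * toC (0 : EuclideanSpace ℝ (Fin 2)) = 0
  rw [show toC (0 : EuclideanSpace ℝ (Fin 2)) = 0 from Complex.ext rfl rfl, mul_zero]

include hF1 in
/-- **The zero set of `F` is the core of the Kas tube**, given that `F` vanishes only at
unsurgered points (`hF0`): a zero `y` of `F` has `bX.incl y = D.jA a` with `w(a) = 0` (as `F y` is a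
positive multiple of `w(a)`), so `y = kasTube (p, 0)`. [folklore] -/
theorem exists_kasTube_eq_of_apply_eq_zero [Nonempty bX.carrier]
    (hF0 : ∀ y : bX.carrier, F y = 0 → ∃ a : ↥(coresComplement h), bX.incl y = D.jA a)
    {y : bX.carrier} (hy : F y = 0) :
    ∃ p : Metric.sphere (0 : EuclideanSpace ℝ (Fin 2)) 1, kasTube D bX hpage (p, 0) = y := by
  obtain ⟨a, ha⟩ := hF0 y hy
  obtain ⟨c, hc, hFc⟩ := hF1 y a ha
  have hwa : w g (a : Base g).1 = 0 := by
    have : (c : ℂ) * w g (a : Base g).1 = 0 := hFc ▸ hy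
    exact (mul_eq_zero.1 this).resolve_left (by exact_mod_cast hc.ne')
  obtain ⟨⟨p, v⟩, hq, hqw⟩ := exists_kasTube_eq D bX hpage ha (by rw [hwa, norm_zero]; norm_num)
  rw [hwa, wTil_eq_zero_iff] at hqw
  have hv : v = 0 := hqw
  subst hv
  exact ⟨p, hq⟩

variable (hF : ContMDiff (𝓡 3) 𝓘(ℝ, ℂ) ∞ F)
  (hF0 : ∀ y : bX.carrier, F y = 0 → ∃ a : ↥(coresComplement h), bX.incl y = D.jA a)
  (hFd : ∀ y : bX.carrier, F y ≠ 0 → ∃ v : EuclideanSpace ℝ (Fin 3),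
    ((starRingEnd ℂ) (F y) * @id ℂ (mfderiv (𝓡 3) 𝓘(ℝ, ℂ) F y v)).im ≠ 0)

/-- **THE KAS OPEN BOOK OF THE SEAM PAGE FUNCTION `F`** (Kas 1980; Gompf–Stipsicz 1999 §8.2;
Etnyre 2006 §2: the boundary of a Lefschetz fibration over `D²` carries the open book whose pages
are the fibres over `∂D²`): ONE binding tube, the Kas tube `Θ ∘ tube_{∂ Base g}` (W5's tube of the
base, living in `{‖w‖ < 1/4}` off all cores, read in `∂X` through `Θ = incl⁻¹ ∘ jA ∘ incl`), and
the fibration `π = F/‖F‖`; normal form because `F ∘ kasTube (p, v)` is a positive multiple of `v`,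
`π` smooth and submersive off the binding `{F = 0}` by the hypotheses on `F`. [cite: Kas1980] -/
def kasOpenBookOf [Nonempty ↥(seamDomain h)] [Nonempty bX.carrier] : OpenBook bX.carrier where
  k := 1
  k_pos := one_pos
  tube := fun _ => kasTube D bX hpage
  proj := argProj F
  isSmoothEmbedding_tube := fun _ => (isSmoothEmbedding_kasTube D bX hpage).1
  isOpen_range_tube := fun _ => (isSmoothEmbedding_kasTube D bX hpage).2
  eq_zero_of_tube_eq := fun _ _ _ _ _ hv =>
    congrArg Prod.snd (injective_kasTube D bX hpage hv)
  proj_tube := fun _ x v hv => by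
    obtain ⟨c, hc, hFc⟩ := apply_kasTube_eq D bX hpage hF1 (x, v)
    rw [coe_argProj_of_eq_mul hc (fun h0 => hv (toC_injective (by
      rw [h0, show toC (0 : EuclideanSpace ℝ (Fin 2)) = 0 from Complex.ext rfl rfl]))) hFc,
      vec2_toC]
  contMDiffOn_proj := by
    refine (contMDiffOn_argProj hF).mono fun y hy hFy => hy ?_
    obtain ⟨p, rfl⟩ := exists_kasTube_eq_of_apply_eq_zero D bX hpage hF1 hF0 hFy
    exact (mem_tubesBinding_iff _ _).2 ⟨0, p, rfl⟩
  angularDeriv_ne_zero := fun y hy => by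
    have hFy : F y ≠ 0 := fun hFy => by
      obtain ⟨p, rfl⟩ := exists_kasTube_eq_of_apply_eq_zero D bX hpage hF1 hF0 hFy
      exact hy ((mem_tubesBinding_iff _ _).2 ⟨0, p, rfl⟩)
    exact angularDeriv_argProj_ne_zero hF hFy (hFd y hFy)

/-- The fibration of the Kas open book is `argProj F` (definitional). [folklore] -/
@[simp] theorem kasOpenBookOf_proj [Nonempty ↥(seamDomain h)] [Nonempty bX.carrier] :
    (kasOpenBookOf D bX hpage hF1 hF hF0 hFd).proj = argProj F := rfl

include hF1 in
/-- **The binding of the Kas open book is the zero set of `F`.** [folklore] -/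
theorem mem_binding_kasOpenBookOf_iff [Nonempty ↥(seamDomain h)] [Nonempty bX.carrier]
    (y : bX.carrier) : y ∈ (kasOpenBookOf D bX hpage hF1 hF hF0 hFd).binding ↔ F y = 0 := by
  rw [OpenBook.mem_binding_iff]
  constructor
  · rintro ⟨-, p, rfl⟩
    exact apply_kasTube_zero D bX hpage hF1 p
  · intro hy
    obtain ⟨p, rfl⟩ := exists_kasTube_eq_of_apply_eq_zero D bX hpage hF1 hF0 hy
    exact ⟨⟨0, one_pos⟩, p, rfl⟩

include hF1 in
/-- **The Kas open book of `F` IS the Kas boundary open book of the Lefschetz handlebody**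
(`IsKasOpenBookOf`): its binding is the image of the base binding `{w = 0}`, and at every unsurgered
point its fibration is the page angle `w/‖w‖` (`F` is a positive multiple of `w` there).
[cite: Kas1980] -/
theorem isKasOpenBookOf_kasOpenBookOf [Nonempty ↥(seamDomain h)] [Nonempty bX.carrier] :
    IsKasOpenBookOf g h D bX.incl (kasOpenBookOf D bX hpage hF1 hF hF0 hFd) := by
  refine ⟨fun y => ?_, fun y a hy hw => ?_⟩
  · rw [OpenBook.mem_binding_iff]
    constructor
    · rintro ⟨-, p, rfl⟩
      refine ⟨seamBasePt h (seamBaseTube hpage (p, 0)), incl_kasTube D bX hpage (p, 0), ?_⟩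
      rw [w_seamBasePt_seamBaseTube]
      show (wsc 0 : ℂ) * toC (0 : EuclideanSpace ℝ (Fin 2)) = 0
      rw [show toC (0 : EuclideanSpace ℝ (Fin 2)) = 0 from Complex.ext rfl rfl, mul_zero]
    · rintro ⟨a, hy, hw⟩
      obtain ⟨⟨p, v⟩, hq, hqw⟩ := exists_kasTube_eq D bX hpage hy (by rw [hw, norm_zero]; norm_num)
      rw [hw, wTil_eq_zero_iff] at hqw
      have hv : v = 0 := hqw
      subst hv
      exact ⟨⟨0, one_pos⟩, p, hq⟩
  · obtain ⟨c, hc, hFc⟩ := hF1 y a hy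
    have hc0 : (c : ℂ) ≠ 0 := by exact_mod_cast hc.ne'
    have hFy : F y ≠ 0 := by rw [hFc]; exact mul_ne_zero hc0 hw
    show toC ((argProj F y : Metric.sphere (0 : EuclideanSpace ℝ (Fin 2)) 1) :
      EuclideanSpace ℝ (Fin 2)) = _
    rw [toC_argProj hFy, hFc, norm_mul, Complex.norm_real, Real.norm_eq_abs, abs_of_pos hc,
      Complex.ofReal_mul, mul_div_mul_left _ _ hc0]

end KasOpenBook

/-! ### §5 The registered node: `helper_kasOpenBook_of_seamFunction` -/

/-- **Node KOB of the NF6 assembly — the Kas open book from a seam page function** (registered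
sub-goal `helper_kasOpenBook_of_seamFunction` of `stub_steinRealisation`; the design's statement
`node_kasOpenBook_of_seamFunction` with `cderiv F y v` unfolded to `mfderiv (𝓡 3) 𝓘(ℝ, ℂ) F y v`).
Let `X = Base g ∪_{h} (2-handles)` with data `D`, all attaching circles in pages, `bX` a boundary
datum and `F : ∂X → ℂ` smooth, a positive multiple of `w(a)` at every unsurgered point
`bX.incl y = D.jA a`, vanishing only at unsurgered points, with `d(arg F) ≠ 0` off its zeros.  Then
the Kas open book `kasOpenBookOf` of `F` has `proj = F/‖F‖` off the binding, binding `{F = 0}`, and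
is the Kas boundary open book of `(h, D)` (`IsKasOpenBookOf`). [cite: Kas1980] -/
theorem helper_kasOpenBook_of_seamFunction : ∀ (g : ℕ) (ι : Type) [Finite ι] (X : Type) [TopologicalSpace X] [T2Space X] [ChartedSpace (EuclideanHalfSpace 4) X] [IsManifold (𝓡∂ 4) ∞ X] (h : ι → Literature.Topology.FourManifolds.HandleAttachingMap 3 2 (Literature.Topology.FourManifolds.LefschetzBase.Base g)) (D : Literature.Topology.FourManifolds.HandleAttachingMap.MultiAttachmentData h (𝓡∂ 4) X) (bX : Literature.Topology.FourManifolds.BoundaryData (𝓡∂ 4) X (𝓡 3)) (F : bX.carrier → ℂ), (∀ i, ∃ c : ℂ, ‖c‖ = 1 ∧ ∀ θ, (h i).attachingCircle θ ∈ Literature.Topology.FourManifolds.LefschetzBase.page g c) → ContMDiff (𝓡 3) 𝓘(ℝ, ℂ) ∞ F → (∀ (y : bX.carrier) (a : ↥(Literature.Topology.FourManifolds.HandleAttachingMap.coresComplement h)), bX.incl y = D.jA a → ∃ c : ℝ, 0 < c ∧ F y = c * Literature.Topology.FourManifolds.LefschetzBase.w g (a : Literature.Topology.FourManifolds.LefschetzBase.Base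 g).1) → (∀ y : bX.carrier, F y = 0 → ∃ a : ↥(Literature.Topology.FourManifolds.HandleAttachingMap.coresComplement h), bX.incl y = D.jA a) → (∀ y : bX.carrier, F y ≠ 0 → ∃ v : EuclideanSpace ℝ (Fin 3), ((starRingEnd ℂ) (F y) * @id ℂ (mfderiv (𝓡 3) 𝓘(ℝ, ℂ) F y v)).im ≠ 0) → ∃ ob : Literature.Geometry.Symplectic.OpenBook bX.carrier, Literature.Geometry.Symplectic.IsKasOpenBookOf g h D bX.incl ob ∧ (∀ y : bX.carrier, F y ≠ 0 → Literature.Topology.FourManifolds.toC ((ob.proj y : Metric.sphere (0 : EuclideanSpace ℝ (Fin 2)) 1) : EuclideanSpace ℝ (Fin 2)) = F y / (‖F y‖ : ℂ)) ∧ (∀ y : bX.carrier, y ∈ ob.binding ↔ F y = 0) := by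
  intro g ι _ X _ _ _ _ h D bX F hpage hF hF1 hF0 hFd
  haveI : Nonempty ↥(seamDomain h) := ⟨seamBaseTube hpage (circlePt0, 0)⟩
  haveI : Nonempty bX.carrier := by
    have hb : D.jA (seamBasePt h (seamBaseTube hpage (circlePt0, 0))) ∈ range bX.incl := by
      rw [bX.range_incl]
      exact (mem_boundary_iff_of_isSmoothEmbedding D.hjA D.hjAo _).2 (seamBasePt_mem_boundary h _)
    obtain ⟨y, -⟩ := hb
    exact ⟨y⟩
  exact ⟨kasOpenBookOf D bX hpage hF1 hF hF0 hFd, isKasOpenBookOf_kasOpenBookOf D bX hpage hF1 hF hF0 hFd,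
    fun y hy => toC_argProj hy, mem_binding_kasOpenBookOf_iff D bX hpage hF1 hF hF0 hFd⟩

end Summit.SmoothPoincare4.SmoothPoincare4.Theorems.AcyclicBisectionExists.ModpBraidOrbits

end
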